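import Literature.MathematicalPhysics.QuantumFieldTheory.Balaban1983to89.B9SmoothHolderClassP
import Literature.MathematicalPhysics.QuantumFieldTheory.Balaban1983to89.B9CoReadingCoordsHolderSNear
import Literature.MathematicalPhysics.QuantumFieldTheory.Balaban1983to89.B9SmoothHolderClassTGradientTools

/-!
# `Balaban1983to89.B9SmoothHolderClassPClosureSN` — T. Bałaban, *Propagators for lattice gauge theories in a background field*, Commun. Math. Phys. **99** (1985) 389–434
# [Balaban1985BackgroundPropagators], Thm 3.1 (3.42)₃ + (3.43)₂ pp. 397–398: a `𝔠`-sup member AND the NEAR site probe members land INTO dag-n06-l's print-weighted transported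
# SITE class `bHZP g s` ∕ its graded version `bHZPG g w` — the SITE twin of `B9SmoothHolderClassTClosure.hasMaj_into_bHZKT_of_probeMaj ∕ hasMaj_into_bHZKG_of_probeFamily`
# at this lineage's carrier `holderProbesSN` (`ΦX U s = probeK b g (wSN s) 1`)

[4] = T. Bałaban, *Propagators and renormalization transformations for lattice gauge theories. II*, Commun. Math. Phys. **96** (1984) 223–250 [`Balaban1984PropagatorsII`].
statement-level skeleton of published theorems with citation tags; proofs where landed; nothing here is a claim about the Yang–Mills mass gap.

THE PRINT.  Thm 3.1 (3.42) p. 397 «|(G′(U)∇\*_Uλ)(x)| ≦ B₀Lʲηe^{−δ₀d(y,y′)}|λ|», (3.43) p. 398 «‖ζG′(U)∇\*_Uλ‖_β ≦ B₀(β)(Lʲη)^{1−β}(‖ζ‖_β + |ζ|)e^{−δ₀d(y,y′)}|λ|», (3.40) p. 397 (the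
transported quotient over `|x − x′| ≦ 1`, i.e. lattice pairs `|z − z′|_T ≦ Lʲ`); [4] (2.51)–(2.54) pp. 232–233.

WHY THIS FILE (cell `pub-ymgap`, node N06 [B9], seat `pub-ymgap-dag-n06-c` g19; the `h43Gp` road, memo `pub-ymgap-dag-n06-c/HPDGW-ROAD.md`).  The certificate's binder `h43Gp` is
`HasMaj 𝔠⁽⁰⁾_{blkBK bI} (bH13 x U) (GcoS … ∘ DvscoKH …) (B₄₃e^{−δ₄₃d})` with `bH13 x U := bHZPG (taxiS U) w13` (dag-n06-l's `B9SmoothHolderClassP`).  n06-k's engine supplies, per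
`s ∈ (0,1)`, the (3.43)₂ PROBE member at the near site carrier (`B9HpDGWFromPinsSN`'s pattern + `B9Eq340ProbeBridgeDstarSN`), and Theorem 3.7's leaf the (3.42)₃ sup member; THIS FILE
lands such a pair INTO `bHZP (taxiS U) s` and an `s`-family INTO `bHZPG (taxiS U) w` — dag-n06-l's bond argument verbatim on sites: a point `q` seen from `Δ̃(y)` (`NearY y q.1`)
lives in the block `y″ = sIK bI q.1` at distance `≤ r` from `y` (LAYER B) and one level up at most, so `Lʲ″η ≤ L·Lʲη` and (2.54) moves the kernel (`e^{δr}`); the class's near pair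
`(q, q′)` (`NearPair`: `|z − z′|_T ≤ Lʲ`, same slot) IS a near site pair of the carrier (`NearS`) with `wEta s q q′ = wSN s q.1 q′.1` (print's units), and its weighted transported
difference IS the pair probe anchored at `y″`, read with `(Lʲη)^{s−1}(Lʲ″η)^{1−s} ≤ L^{1−s} ≤ L`; sup channel `(Lʲη)^{s−1}(Lʲη)^{−s}·Lʲ″η ≤ L`.
* §1 ★ `probeK_inl_eq_wSN_mul_trDif`, ★ `nearS_of_nearPair`, ★ `wEta_eq_wSN_of_nearPair`, ★ `len_sIK_le_of_nearY` (`Lʲ″η ≤ L·Lʲη`).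
* §2 ★★★ `hasMaj_into_bHZP_of_probeMajSN` — source ANY class `b₁`: `T : b₁ → 𝔠^{(−1)}_{blkSK(sIK bI)}` (`C e^{−δd}`) and `probeK b g (wSN s) 1 ∘ T : b₁ → 𝔠_P^{(s−1)}_{blkPK(sIK bI)}`
  (`C_b e^{−δd}`) ⟹ `T : b₁ → bHZP g s` with `L·(C + C_b)·e^{δr}·e^{−δd}`; ★★ `hasMaj_into_bHZPG_of_probeFamilySN` — an `s ∈ (0,1)` family with `w s·C_b(s) ≤ C_b₀` lands in
  `bHZPG g w` with `L·(C + C_b₀)·e^{δr}·e^{−δd}`; ★★ `…_near` editions with the LAYER-B radius `r := rNear + 1` discharged by the certificate's `hβ1` (dag-n06-w6 `dist_sIK_le_of_nearY`).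
HONEST SCOPE.  Class bookkeeping ([4] (2.51)–(2.54)); the members are HYPOTHESES of printed species, nothing of [B9] asserted; constants ours; COUNT-NEUTRAL; N06 NOT discharged; nothing
continuum, nothing about the mass gap.  Cell `pub-ymgap` (HUMAN RULING D-0062), Track A node N06 [B9], seat `pub-ymgap-dag-n06-c` (g19), 2026-08-29; a NEW file; 0 `def`, no `sorry`,
no `axiom`, no `instance`, no `notation`.
-/

noncomputable section

namespace Literature.MathematicalPhysics.QuantumFieldTheory.Balaban1983to89.B9SmoothHolderClassPClosureSN

open B6GlobalChartV1 (PV blkV1)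
open B6Geom246MultiLevelTorus (geomT torusSupNorm_neg)
open B6Ineq2142KLevelV1 (β lvl)
open B6KLevelCensusIndexV1 (KIdx)
open B6MultiLevelTorusOperator (one_le_of_mem)
open B6Prop22KLevelTorusCensusEta (nKT)
open B9GeoNormsKLevelV1 (geo9K)
open B9GeoLemma21KLevelV1 (geo9K_dist_triangle geo9K_len_pos)
open B9Thm34Ext (toB6)
open B11SectG (BlockNorm HasMaj)
open B11SectGGlobal (Size)
open B11SectGGlobalSizes
open B11SectGSmoothCutT (Size.ofPairsT ofPairsT_sz_le)
open B9Thm312WholeClasses (cNormR cNormR_loc)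
open B9Eq39Adjoint (R)
open B9CoReadingCoords (assembleK)
open B9CoReadingCoordsS (XSK blkSK sIK)
open B9CoReadingCoordsHolder (PK blkPK probeK probeK_inl)
open B9CoReadingCoordsHolderS (wS)
open B9CoReadingCoordsHolderSNear (NearS wSN wSN_of_near wSN_nonneg)
open B9MultiscaleSmoothPartitionY (scl scl_pos NearY levY_window_of_nearY)
open B9MultiscaleSmoothPartitionYNear (rNear dist_sIK_le_of_nearY)
open B9SmoothHolderClassS (NearPair wEta wEta_nonneg Wscl Wscl_nonneg scl_div_nKT_pos_le_one one_le_Wscl)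
open B9SmoothHolderClassT (trDif trDif_apply)
open B9SmoothHolderClassTClosure (abs_apply_le_of_hasMaj_cNormR len_rpow_neg_eq_Wscl len_le_one len_eq_scl_div)
open B9SmoothHolderClassP (bHZP bHZP_loc bHZPG hasMaj_into_bHZPG)
open B9SmoothHolderClassTGradientTools (lvl_sIK_eq_levY)
open B9GradViaDivLettersSmoothTerms (Wscl_le_of_lvl_le)
open Node00 (SiteY FBondY IBondY toKT levY)

variable {d ℓ : ℕ} {hd : 1 ≤ d + 1} {hL : Odd (ℓ + 1) ∧ 1 < ℓ + 1} {b₀ b₁ : ℝ}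
variable {𝔸 : Type} [NormedRing 𝔸] [NormedAlgebra ℂ 𝔸] [CompleteSpace 𝔸]
variable {κ : Type} [Fintype κ]
variable (i : KIdx d ℓ hd hL b₀ b₁)

/-! ## §1 The dictionary: the class's near pairs ARE the carrier's near site pairs, with the same weight -/

section Dictionary

variable (b : Module.Basis κ ℝ 𝔸)

omit [CompleteSpace 𝔸] in
/-- ★ the PAIR probe of the near carrier at `((q.1, q′.1), q.2)` reads `wSN s q.1 q′.1 · trDif b g q q′ F`. [cite: Balaban1985BackgroundPropagators, (3.40) p.397, bookkeeping] -/
theorem probeK_inl_eq_wSN_mul_trDif (g : SiteY i → SiteY i → 𝔸ˣ) (s : ℝ) (F : XSK κ i → ℝ) (q q' : XSK κ i) :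
    probeK b g (wSN i s) (fun _ => (1 : ℝ)) F (Sum.inl ((q.1, q'.1), q.2)) = wSN i s q.1 q'.1 * trDif b g q q' F := by
  rw [probeK_inl, trDif_apply]

omit [NormedAlgebra ℂ 𝔸] [CompleteSpace 𝔸] [Fintype κ] in
/-- ★ a near pair of the class (`|z − z′|_T ≤ L^{j(z)}`, same slot) is a near site pair of the carrier. [cite: Balaban1985BackgroundPropagators, (3.40) p.397 («|x − x′| ≦ 1»), bookkeeping] -/
theorem nearS_of_nearPair {q q' : XSK κ i} (h : NearPair i q q') : NearS i q.1 q'.1 := h.2.1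

omit [NormedAlgebra ℂ 𝔸] [CompleteSpace 𝔸] [Fintype κ] in
/-- ★ on a near pair the class's η-scale weight IS the carrier's: `wEta s q q′ = wSN s q.1 q′.1` (the torus sup norm is even). [cite: Balaban1985BackgroundPropagators, (3.40) p.397; Balaban1984PropagatorsII, (2.67) p.234] -/
theorem wEta_eq_wSN_of_nearPair (s : ℝ) {q q' : XSK κ i} (h : NearPair i q q') : wEta i s q q' = wSN i s q.1 q'.1 := by
  rw [wSN_of_near i s (nearS_of_nearPair i h), wEta, wS, ← neg_sub, torusSupNorm_neg (fun μ => one_le_of_mem q.1.2 μ)]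

omit [NormedAlgebra ℂ 𝔸] [CompleteSpace 𝔸] [Fintype κ] in
/-- ★ a site seen from `Δ̃(y)` has its index block one level up at most: `Lʲ″η ≤ L·Lʲη` for `y″ = sIK bI z` (level-faithful `bI`, print's units).
[cite: Balaban1984PropagatorsII, (2.45)–(2.47) p.231 + (2.1) p.224; Balaban1985BackgroundPropagators, (3.43) p.398 («Δ̃(y)»)] -/
theorem len_sIK_le_of_nearY [Fintype (geo9K i).Site] {bI : FBondY i → IBondY i} (hlev : ∀ f : FBondY i, lvl i.hN i.D i.hk (bI f) = (blkV1 i.hN i.D f).1.1)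
    (hcf : |i.cf| = (nKT (toKT i) : ℝ)) {y : IBondY i} {z : SiteY i} (h : NearY i y z) :
    (geo9K i).len (sIK i bI z) ≤ (((ℓ + 1 : ℕ) : ℝ)) * (geo9K i).len y := by
  have hlvl : lvl i.hN i.D i.hk (sIK i bI z) ≤ lvl i.hN i.D i.hk y + 1 := by
    rw [lvl_sIK_eq_levY i hlev]; exact (levY_window_of_nearY i h).2
  have hW := Wscl_le_of_lvl_le i zero_le_one (k := 1) hlvl
  simp only [Nat.cast_one, one_mul, Real.rpow_one] at hW
  rw [← len_rpow_neg_eq_Wscl i hcf, ← len_rpow_neg_eq_Wscl i hcf, Real.rpow_neg_one, Real.rpow_neg_one] at hW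
  have hy : 0 < (geo9K i).len y := geo9K_len_pos i y
  have hz : 0 < (geo9K i).len (sIK i bI z) := geo9K_len_pos i _
  have h1 : (geo9K i).len (sIK i bI z) / (geo9K i).len y ≤ ((ℓ + 1 : ℕ) : ℝ) := by
    rw [div_eq_mul_inv]
    calc (geo9K i).len (sIK i bI z) * ((geo9K i).len y)⁻¹
        ≤ (geo9K i).len (sIK i bI z) * ((((ℓ + 1 : ℕ) : ℝ)) * ((geo9K i).len (sIK i bI z))⁻¹) := mul_le_mul_of_nonneg_left hW hz.le
      _ = ((ℓ + 1 : ℕ) : ℝ) := by field_simp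
  exact (div_le_iff₀ hy).mp h1

end Dictionary

/-! ## §2 ★★★ A 𝔠-sup member plus the near probe members give a member INTO the print-weighted site class -/

section Main

variable [Fintype (geo9K i).Site] (b : Module.Basis κ ℝ 𝔸) (g : SiteY i → SiteY i → 𝔸ˣ) {R : ℝ} {H : Prop}
variable (hlen : ∀ y : (geo9K i).Site, 0 ≤ (geo9K i).len y) {bI : FBondY i → IBondY i}
variable {F₁ : Type} [AddCommGroup F₁] [Module ℝ F₁]

omit [CompleteSpace 𝔸] in
/-- ★★★ **THE CLOSURE OF THE PRINT-WEIGHTED SITE CLASS UNDER «𝔠-SUP ⊔ NEAR PROBE» MEMBERS.**  For ANY source class `b₁`, ANY site table `g`, `0 < s < 1`: if `T` is bounded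
into `𝔠^{(−1)}_{blkSK(sIK bI)}` with `C·e^{−δd}` ((3.42)₃-type word) and `probeK b g (wSN s) 1 ∘ T` — the near carrier's `(holderProbesSN …).ΦX U s ∘ T` — into
`𝔠_P^{(s−1)}_{blkPK(sIK bI)}` with `C_b·e^{−δd}` ((3.43)₂-type word), then `T` is bounded INTO `bHZP g s` with `L·(C + C_b)·e^{δr}·e^{−δd}`.  Binders: the certificate's `hlev`,
the LAYER-B radius `hN`, print's units `hcf`. [cite: Balaban1985BackgroundPropagators, (3.40) p.397 + (3.42)–(3.43) pp.397–398; Balaban1984PropagatorsII, (2.51)–(2.54) pp.232–233, (2.1) p.224] -/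
theorem hasMaj_into_bHZP_of_probeMajSN {s : ℝ} (hs0 : 0 < s) (hs1 : s < 1)
    (hlev : ∀ f : FBondY i, lvl i.hN i.D i.hk (bI f) = (blkV1 i.hN i.D f).1.1)
    {r δ : ℝ} (hδ : 0 ≤ δ) (hN : ∀ (y : IBondY i) (z : SiteY i), NearY i y z → (geo9K i).dist y (sIK i bI z) ≤ r)
    (hcf : |i.cf| = (nKT (toKT i) : ℝ))
    {b₁ : BlockNorm (toB6 (geo9K i) R H) F₁} {T : F₁ →ₗ[ℝ] (XSK κ i → ℝ)} {C Cb : ℝ} (hC : 0 ≤ C) (hCb : 0 ≤ Cb)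
    (hsup : HasMaj b₁ (cNormR R H (blkSK i (sIK i bI)) hlen (-1)) T (fun a a' => C * Real.exp (-(δ * (geo9K i).dist a a'))))
    (hpr : HasMaj b₁ (cNormR R H (blkPK (sIK i bI)) hlen (s - 1)) (probeK b g (wSN i s) (fun _ => (1 : ℝ)) ∘ₗ T)
      (fun a a' => Cb * Real.exp (-(δ * (geo9K i).dist a a')))) :
    HasMaj b₁ (bHZP (κ := κ) i b g (R := R) (H := H) (s := s) hs0.le hs1.le) T
      (fun y y' => (((ℓ + 1 : ℕ) : ℝ)) * (C + Cb) * Real.exp (δ * r) * Real.exp (-(δ * (geo9K i).dist y y'))) := by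
  classical
  intro y' μ hμ y
  rw [bHZP_loc]
  set L : ℝ := ((ℓ + 1 : ℕ) : ℝ) with hLdef
  have hL1 : (1 : ℝ) ≤ L := by rw [hLdef]; exact_mod_cast Nat.succ_le_succ (Nat.zero_le ℓ)
  have hL0 : 0 ≤ L := zero_le_one.trans hL1
  set E : ℝ := Real.exp (δ * r) * Real.exp (-(δ * (geo9K i).dist y y')) with hE
  have hE0 : 0 ≤ E := by positivity
  have hl0 : 0 ≤ b₁.loc y' μ := b₁.loc_nonneg _ _
  have hy : 0 < (geo9K i).len y := geo9K_len_pos i y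
  -- (2.54): moving the kernel from the block of the value to `y`
  have hexp : ∀ z : SiteY i, NearY i y z → Real.exp (-(δ * (geo9K i).dist (sIK i bI z) y')) ≤ E := by
    intro z hz
    rw [hE, ← Real.exp_add]
    refine Real.exp_le_exp.2 ?_
    nlinarith [mul_le_mul_of_nonneg_left (geo9K_dist_triangle i y (sIK i bI z) y') hδ, mul_le_mul_of_nonneg_left (hN y z hz) hδ]
  -- the two class weights multiply to `(Lʲη)⁻¹`; the pair weight is `(Lʲη)^{s−1}`
  have hW1 : Wscl i (1 - s) y = (geo9K i).len y ^ (s - 1) := by rw [← len_rpow_neg_eq_Wscl i hcf, neg_sub]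
  have hWs : Wscl i s y = (geo9K i).len y ^ (-s) := by rw [← len_rpow_neg_eq_Wscl i hcf]
  have hWW : Wscl i (1 - s) y * Wscl i s y = ((geo9K i).len y)⁻¹ := by
    rw [hW1, hWs, ← Real.rpow_add hy, show s - 1 + -s = -1 by ring, Real.rpow_neg_one]
  have hW10 : 0 ≤ Wscl i (1 - s) y := Wscl_nonneg i _ _
  have hWs0 : 0 ≤ Wscl i s y := Wscl_nonneg i _ _
  -- THE SUP PART, value by value: `|Tμ(q)| ≤ Lʲ″η·C·e ≤ L·Lʲη·C·E`
  set M : ℝ := L * (geo9K i).len y * C * E * b₁.loc y' μ with hM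
  have hM0 : 0 ≤ M := by positivity
  have hpt : ∀ q : XSK κ i, NearY i y q.1 → |T μ q| ≤ M := by
    intro q hq
    have hv := abs_apply_le_of_hasMaj_cNormR i hlen hsup hμ q
    have hblk : blkSK i (sIK i bI) q = sIK i bI q.1 := rfl
    have hz : 0 < (geo9K i).len (sIK i bI q.1) := geo9K_len_pos i _
    rw [hblk, Real.rpow_neg_one, inv_inv] at hv
    have hlenle := len_sIK_le_of_nearY i hlev hcf (bI := bI) hq
    have hCe : C * Real.exp (-(δ * (geo9K i).dist (sIK i bI q.1) y')) ≤ C * E := mul_le_mul_of_nonneg_left (hexp q.1 hq) hC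
    calc |T μ q| ≤ (geo9K i).len (sIK i bI q.1) * (C * Real.exp (-(δ * (geo9K i).dist (sIK i bI q.1) y'))) * b₁.loc y' μ := hv
      _ ≤ (L * (geo9K i).len y) * (C * E) * b₁.loc y' μ :=
          mul_le_mul_of_nonneg_right (mul_le_mul hlenle hCe (by positivity) (by positivity)) hl0
      _ = M := by rw [hM]; ring
  have hsupPart : Wscl i (1 - s) y * (Wscl i s y * (Size.ofSup (toB6 (geo9K i) R H) (fun (q : XSK κ i) (y : IBondY i) => NearY i y q.1)).sz y (T μ)) ≤
      L * C * E * b₁.loc y' μ := by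
    have h1 : (Size.ofSup (toB6 (geo9K i) R H) (fun (q : XSK κ i) (y : IBondY i) => NearY i y q.1)).sz y (T μ) ≤ M :=
      ofSup_sz_le _ hM0 fun q hq => hpt q hq
    calc Wscl i (1 - s) y * (Wscl i s y * _) = (Wscl i (1 - s) y * Wscl i s y) * _ := by ring
      _ ≤ (Wscl i (1 - s) y * Wscl i s y) * M := mul_le_mul_of_nonneg_left h1 (mul_nonneg hW10 hWs0)
      _ = (((geo9K i).len y)⁻¹ * (geo9K i).len y) * (L * C * E * b₁.loc y' μ) := by rw [hWW, hM]; ring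
      _ = L * C * E * b₁.loc y' μ := by rw [inv_mul_cancel₀ hy.ne', one_mul]
  -- THE PAIR PART, probe by probe: `(Lʲη)^{s−1}·wEta·|Δ^g| = (Lʲη)^{s−1}|pair probe| ≤ (Lʲ″η ∕ Lʲη)^{1−s}·C_b·e ≤ L·C_b·E`
  set M₂ : ℝ := (Wscl i (1 - s) y)⁻¹ * (L * Cb * E * b₁.loc y' μ) with hM₂
  have hW1pos : 0 < Wscl i (1 - s) y := lt_of_lt_of_le zero_lt_one (one_le_Wscl i (by linarith) y)
  have hM₂0 : 0 ≤ M₂ := by positivity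
  have hpair : ∀ q q' : XSK κ i, NearY i y q.1 → NearPair i q q' → wEta i s q q' * |trDif b g q q' (T μ)| ≤ M₂ := by
    intro q q' hq hqq
    rw [wEta_eq_wSN_of_nearPair i s hqq, ← abs_of_nonneg (wSN_nonneg i s q.1 q'.1), ← abs_mul, ← probeK_inl_eq_wSN_mul_trDif i b g s (T μ) q q',
      ← LinearMap.comp_apply]
    -- the pair probe is anchored at `sIK bI q.1` (`blkPK_inl`, definitional)
    have hv : |(probeK b g (wSN i s) (fun _ => (1 : ℝ)) ∘ₗ T) μ (Sum.inl ((q.1, q'.1), q.2))| ≤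
        ((geo9K i).len (sIK i bI q.1) ^ (s - 1))⁻¹ * (Cb * Real.exp (-(δ * (geo9K i).dist (sIK i bI q.1) y'))) * b₁.loc y' μ :=
      abs_apply_le_of_hasMaj_cNormR i hlen hpr hμ (Sum.inl ((q.1, q'.1), q.2))
    have hz : 0 < (geo9K i).len (sIK i bI q.1) := geo9K_len_pos i _
    have hlenle := len_sIK_le_of_nearY i hlev hcf (bI := bI) hq
    -- `(Lʲ″η)^{1−s} ≤ L^{1−s}(Lʲη)^{1−s} ≤ L·(Wscl (1−s) y)⁻¹`
    have hpow : ((geo9K i).len (sIK i bI q.1) ^ (s - 1))⁻¹ ≤ L * (Wscl i (1 - s) y)⁻¹ := by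
      rw [← Real.rpow_neg hz.le, neg_sub, hW1, ← Real.rpow_neg hy.le, neg_sub]
      calc (geo9K i).len (sIK i bI q.1) ^ (1 - s) ≤ (L * (geo9K i).len y) ^ (1 - s) :=
            Real.rpow_le_rpow hz.le hlenle (by linarith)
        _ = L ^ (1 - s) * (geo9K i).len y ^ (1 - s) := Real.mul_rpow hL0 hy.le
        _ ≤ L * (geo9K i).len y ^ (1 - s) := by
            refine mul_le_mul_of_nonneg_right ?_ (Real.rpow_nonneg hy.le _)
            calc L ^ (1 - s) ≤ L ^ (1 : ℝ) := Real.rpow_le_rpow_of_exponent_le hL1 (by linarith)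
              _ = L := Real.rpow_one L
    have hCe : Cb * Real.exp (-(δ * (geo9K i).dist (sIK i bI q.1) y')) ≤ Cb * E := mul_le_mul_of_nonneg_left (hexp q.1 hq) hCb
    calc _ ≤ ((geo9K i).len (sIK i bI q.1) ^ (s - 1))⁻¹ * (Cb * Real.exp (-(δ * (geo9K i).dist (sIK i bI q.1) y'))) * b₁.loc y' μ := hv
      _ ≤ (L * (Wscl i (1 - s) y)⁻¹) * (Cb * E) * b₁.loc y' μ :=
          mul_le_mul_of_nonneg_right (mul_le_mul hpow hCe (by positivity) (by positivity)) hl0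
      _ = M₂ := by rw [hM₂]; ring
  have hpairPart : Wscl i (1 - s) y * (Size.ofPairsT (toB6 (geo9K i) R H) (fun (q : XSK κ i) (y : IBondY i) => NearY i y q.1) (NearPair i) (wEta i s)
        (wEta_nonneg i s) (trDif b g)).sz y (T μ) ≤ L * Cb * E * b₁.loc y' μ := by
    have h1 : (Size.ofPairsT (toB6 (geo9K i) R H) (fun (q : XSK κ i) (y : IBondY i) => NearY i y q.1) (NearPair i) (wEta i s) (wEta_nonneg i s)
        (trDif b g)).sz y (T μ) ≤ M₂ :=
      ofPairsT_sz_le _ _ _ _ _ hM₂0 fun q q' (hq : NearY i y q.1) (hqq : NearPair i q q') => hpair q q' hq hqq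
    calc Wscl i (1 - s) y * _ ≤ Wscl i (1 - s) y * M₂ := mul_le_mul_of_nonneg_left h1 hW10
      _ = L * Cb * E * b₁.loc y' μ := by rw [hM₂, ← mul_assoc, mul_inv_cancel₀ hW1pos.ne', one_mul]
  rw [mul_add]
  refine le_trans (add_le_add hsupPart hpairPart) (le_of_eq ?_)
  rw [hE]
  dsimp only
  ring

/-! ## §3 ★★ An ∀ s family of near probe members lands ONCE in the graded print-weighted class -/

omit [CompleteSpace 𝔸] in
/-- ★★ **THE LANDING ADAPTER ON THE SITE CARRIER**: a `𝔠^{(−1)}`-sup member (`C·e^{−δd}`) plus an ∀ s ∈ (0,1) family of near probe members (`C_b(s)·e^{−δd}`, `B₀(s) → ∞` allowed)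
is bounded INTO THE GRADED CLASS `bHZPG g w` with `L·(C + C_b₀)·e^{δr}·e^{−δd}` as soon as `w s·C_b(s) ≤ C_b₀` — the shape of the certificate's `h43Gp` at `g := taxiS U`, `w := w13`.
[cite: Balaban1985BackgroundPropagators, Thm 3.1 p.397 («B₀(β) → ∞ if β → 1») + (3.42)–(3.43) pp.397–398; Balaban1984PropagatorsII, (2.51)–(2.54) pp.232–233] -/
theorem hasMaj_into_bHZPG_of_probeFamilySN (w : ℝ → ℝ) (hw0 : ∀ s, 0 ≤ w s) (hw1 : ∀ s, w s ≤ 1)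
    (hlev : ∀ f : FBondY i, lvl i.hN i.D i.hk (bI f) = (blkV1 i.hN i.D f).1.1)
    {r δ : ℝ} (hδ : 0 ≤ δ) (hN : ∀ (y : IBondY i) (z : SiteY i), NearY i y z → (geo9K i).dist y (sIK i bI z) ≤ r)
    (hcf : |i.cf| = (nKT (toKT i) : ℝ))
    {b₁ : BlockNorm (toB6 (geo9K i) R H) F₁} {T : F₁ →ₗ[ℝ] (XSK κ i → ℝ)} {C Cb₀ : ℝ} {Cb : ℝ → ℝ} (hC : 0 ≤ C) (hCb₀ : 0 ≤ Cb₀)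
    (hCb : ∀ s, 0 < s → s < 1 → 0 ≤ Cb s) (hwCb : ∀ s, 0 < s → s < 1 → w s * Cb s ≤ Cb₀)
    (hsup : HasMaj b₁ (cNormR R H (blkSK i (sIK i bI)) hlen (-1)) T (fun a a' => C * Real.exp (-(δ * (geo9K i).dist a a'))))
    (hpr : ∀ s, 0 < s → s < 1 → HasMaj b₁ (cNormR R H (blkPK (sIK i bI)) hlen (s - 1)) (probeK b g (wSN i s) (fun _ => (1 : ℝ)) ∘ₗ T)
      (fun a a' => Cb s * Real.exp (-(δ * (geo9K i).dist a a')))) :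
    HasMaj b₁ (bHZPG (κ := κ) i b g (R := R) (H := H) w hw0 hw1) T
      (fun y y' => (((ℓ + 1 : ℕ) : ℝ)) * (C + Cb₀) * Real.exp (δ * r) * Real.exp (-(δ * (geo9K i).dist y y'))) := by
  have hL0 : (0 : ℝ) ≤ ((ℓ + 1 : ℕ) : ℝ) := Nat.cast_nonneg _
  refine hasMaj_into_bHZPG i b g w hw0 hw1
    (K := fun s y y' => (((ℓ + 1 : ℕ) : ℝ)) * (C + Cb s) * Real.exp (δ * r) * Real.exp (-(δ * (geo9K i).dist y y')))
    (fun _ _ => by positivity) (fun s hs0 hs1 a c => ?_) fun s hs0 hs1 =>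
      hasMaj_into_bHZP_of_probeMajSN i b g hlen hs0 hs1 hlev hδ hN hcf hC (hCb s hs0 hs1) hsup (hpr s hs0 hs1)
  -- `w s·L(C + C_b s) ≤ L(C + C_b₀)`
  have h1 : w s * C ≤ C := mul_le_of_le_one_left hC (hw1 s)
  have h2 := hwCb s hs0 hs1
  have hE0 : 0 ≤ (((ℓ + 1 : ℕ) : ℝ)) * (Real.exp (δ * r) * Real.exp (-(δ * (geo9K i).dist a c))) := by positivity
  calc w s * ((((ℓ + 1 : ℕ) : ℝ)) * (C + Cb s) * Real.exp (δ * r) * Real.exp (-(δ * (geo9K i).dist a c)))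
      = (w s * C + w s * Cb s) * ((((ℓ + 1 : ℕ) : ℝ)) * (Real.exp (δ * r) * Real.exp (-(δ * (geo9K i).dist a c)))) := by ring
    _ ≤ (C + Cb₀) * ((((ℓ + 1 : ℕ) : ℝ)) * (Real.exp (δ * r) * Real.exp (-(δ * (geo9K i).dist a c)))) :=
        mul_le_mul_of_nonneg_right (add_le_add h1 h2) hE0
    _ = _ := by ring

/-! ## §4 The radius discharged by LAYER B -/

omit [CompleteSpace 𝔸] in
/-- ★★ §2 with the LAYER-B radius discharged (dag-n06-w6 `dist_sIK_le_of_nearY`, `r := rNear d ℓ + 1`): binders = the certificate's `hβ1 hlev` + print's units.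
[cite: Balaban1985BackgroundPropagators, (3.40) p.397 + (3.42)–(3.43) pp.397–398; Balaban1984PropagatorsII, (2.51)–(2.54) pp.232–233] -/
theorem hasMaj_into_bHZP_of_probeMajSN_near {s : ℝ} (hs0 : 0 < s) (hs1 : s < 1)
    (hβ1 : ∀ f : FBondY i, (geomT i.D).dist (β i.hN i.D i.hk (bI f)) (blkV1 i.hN i.D f) ≤ 1)
    (hlev : ∀ f : FBondY i, lvl i.hN i.D i.hk (bI f) = (blkV1 i.hN i.D f).1.1)
    {δ : ℝ} (hδ : 0 ≤ δ) (hcf : |i.cf| = (nKT (toKT i) : ℝ))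
    {b₁ : BlockNorm (toB6 (geo9K i) R H) F₁} {T : F₁ →ₗ[ℝ] (XSK κ i → ℝ)} {C Cb : ℝ} (hC : 0 ≤ C) (hCb : 0 ≤ Cb)
    (hsup : HasMaj b₁ (cNormR R H (blkSK i (sIK i bI)) hlen (-1)) T (fun a a' => C * Real.exp (-(δ * (geo9K i).dist a a'))))
    (hpr : HasMaj b₁ (cNormR R H (blkPK (sIK i bI)) hlen (s - 1)) (probeK b g (wSN i s) (fun _ => (1 : ℝ)) ∘ₗ T)
      (fun a a' => Cb * Real.exp (-(δ * (geo9K i).dist a a')))) :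
    HasMaj b₁ (bHZP (κ := κ) i b g (R := R) (H := H) (s := s) hs0.le hs1.le) T
      (fun y y' => (((ℓ + 1 : ℕ) : ℝ)) * (C + Cb) * Real.exp (δ * (rNear d ℓ + 1)) * Real.exp (-(δ * (geo9K i).dist y y'))) :=
  hasMaj_into_bHZP_of_probeMajSN i b g hlen hs0 hs1 hlev hδ (fun _ _ h => dist_sIK_le_of_nearY i hβ1 h) hcf hC hCb hsup hpr

omit [CompleteSpace 𝔸] in
/-- ★★ §3 with the LAYER-B radius discharged. [cite: Balaban1985BackgroundPropagators, Thm 3.1 p.397 + (3.43) p.398; Balaban1984PropagatorsII, (2.51)–(2.54) pp.232–233] -/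
theorem hasMaj_into_bHZPG_of_probeFamilySN_near (w : ℝ → ℝ) (hw0 : ∀ s, 0 ≤ w s) (hw1 : ∀ s, w s ≤ 1)
    (hβ1 : ∀ f : FBondY i, (geomT i.D).dist (β i.hN i.D i.hk (bI f)) (blkV1 i.hN i.D f) ≤ 1)
    (hlev : ∀ f : FBondY i, lvl i.hN i.D i.hk (bI f) = (blkV1 i.hN i.D f).1.1)
    {δ : ℝ} (hδ : 0 ≤ δ) (hcf : |i.cf| = (nKT (toKT i) : ℝ))
    {b₁ : BlockNorm (toB6 (geo9K i) R H) F₁} {T : F₁ →ₗ[ℝ] (XSK κ i → ℝ)} {C Cb₀ : ℝ} {Cb : ℝ → ℝ} (hC : 0 ≤ C) (hCb₀ : 0 ≤ Cb₀)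
    (hCb : ∀ s, 0 < s → s < 1 → 0 ≤ Cb s) (hwCb : ∀ s, 0 < s → s < 1 → w s * Cb s ≤ Cb₀)
    (hsup : HasMaj b₁ (cNormR R H (blkSK i (sIK i bI)) hlen (-1)) T (fun a a' => C * Real.exp (-(δ * (geo9K i).dist a a'))))
    (hpr : ∀ s, 0 < s → s < 1 → HasMaj b₁ (cNormR R H (blkPK (sIK i bI)) hlen (s - 1)) (probeK b g (wSN i s) (fun _ => (1 : ℝ)) ∘ₗ T)
      (fun a a' => Cb s * Real.exp (-(δ * (geo9K i).dist a a')))) :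
    HasMaj b₁ (bHZPG (κ := κ) i b g (R := R) (H := H) w hw0 hw1) T
      (fun y y' => (((ℓ + 1 : ℕ) : ℝ)) * (C + Cb₀) * Real.exp (δ * (rNear d ℓ + 1)) * Real.exp (-(δ * (geo9K i).dist y y'))) :=
  hasMaj_into_bHZPG_of_probeFamilySN i b g hlen w hw0 hw1 hlev hδ (fun _ _ h => dist_sIK_le_of_nearY i hβ1 h) hcf hC hCb₀ hCb hwCb hsup hpr

end Main

end Literature.MathematicalPhysics.QuantumFieldTheory.Balaban1983to89.B9SmoothHolderClassPClosureSN

end
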